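import Literature.Analysis.Complex.KoebeDistortion
import Mathlib.Analysis.Complex.RemovableSingularity
import Mathlib.Analysis.Complex.AbsMax
import Mathlib.Analysis.Complex.Schwarz
import HarnessLib

/-!
# Univalent functions are close to their linearisation at the centre

A quantitative consequence of the Koebe growth theorem (`KoebeDistortion`): for `f`
holomorphic and injective on `B(0, R)` and `‖w‖ < R/2`,

  `‖f(w) - f(0) - f'(0) w‖ ≤ 10 ‖f'(0)‖ ‖w‖² / R`

(`norm_sub_linear_le`): the function `(f(ζ) - f(0) - f'(0)ζ)/ζ` is holomorphic on the disc,
vanishes at `0`, and is bounded by `5 ‖f'(0)‖` on `|ζ| = R/2` by the growth theorem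
(`AreaThm.distortion_ball`), so the maximum principle and the Schwarz lemma apply. The point
is that the error is RELATIVE to `‖f'(0)‖`, uniformly over all univalent `f`.

Consequence used for [LSW] Lemma 6.3 (`image_mem_cone_of_univalent`): if moreover
`f(0) = 0` and `f'(0) = d > 0`, points of the cone `{|re z| ≤ c im z}` close to `0` are mapped
into the cone `{|re z| ≤ (2c + 1) im z}`, with `‖f(z)‖` within a factor `1 ± 1/4` of `d ‖z‖`.

Pommerenke, *Boundary Behaviour of Conformal Maps* (1992), Thm. 1.3 (growth theorem) is the
input; the statement itself is folklore.
-/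

noncomputable section

open Set Filter Metric Topology Function Complex

namespace Literature.Analysis.Complex

variable {f : ℂ → ℂ} {R : ℝ}

/-- **Linearisation error for univalent maps**: for `f` holomorphic and injective on `B(0, R)`
and `‖w‖ < R/2`, `‖f(w) - f(0) - f'(0) w‖ ≤ 10 ‖f'(0)‖ ‖w‖²/R`. [folklore] -/
theorem norm_sub_linear_le (hR : 0 < R) (hf : DifferentiableOn ℂ f (ball (0 : ℂ) R))
    (hinj : InjOn f (ball (0 : ℂ) R)) {w : ℂ} (hw : ‖w‖ < R / 2) :
    ‖f w - f 0 - deriv f 0 * w‖ ≤ 10 * ‖deriv f 0‖ * ‖w‖ ^ 2 / R := by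
  set d : ℂ := deriv f 0 with hd
  set h : ℂ → ℂ := fun ζ ↦ f ζ - f 0 - d * ζ with hh
  have hhd : DifferentiableOn ℂ h (ball (0 : ℂ) R) :=
    (hf.sub (differentiableOn_const _)).sub ((differentiableOn_const _).mul differentiableOn_id)
  have hh0 : h 0 = 0 := by simp [hh]
  set k : ℂ → ℂ := dslope h 0 with hk
  have hkd : DifferentiableOn ℂ k (ball (0 : ℂ) R) :=
    (Complex.differentiableOn_dslope (ball_mem_nhds 0 hR)).2 hhd
  have hk0 : k 0 = 0 := by
    rw [hk, dslope_same]
    have hf' : HasDerivAt f (deriv f 0) 0 := (hf.differentiableAt (ball_mem_nhds 0 hR)).hasDerivAt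
    have h1 : HasDerivAt (fun ζ : ℂ ↦ f ζ - f 0 - d * ζ) (deriv f 0 - d * 1) 0 :=
      (hf'.sub_const (f 0)).sub ((hasDerivAt_id (0 : ℂ)).const_mul d)
    rw [hh, h1.deriv, hd, mul_one, sub_self]
  have hkval : ∀ ζ : ℂ, ζ ≠ 0 → k ζ = h ζ / ζ := fun ζ hζ ↦ by
    rw [hk, dslope_of_ne _ hζ, slope_def_field, hh0, sub_zero, sub_zero]
  -- bound on the circle `|ζ| = R/2`, hence on the closed disc (maximum principle)
  have hR2 : 0 < R / 2 := by positivity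
  have hclsub : closure (ball (0 : ℂ) (R / 2)) ⊆ ball (0 : ℂ) R :=
    closure_ball_subset_closedBall.trans (closedBall_subset_ball (by linarith))
  have hsphere : ∀ ζ ∈ frontier (ball (0 : ℂ) (R / 2)), ‖k ζ‖ ≤ 5 * ‖d‖ := by
    intro ζ hζ
    rw [frontier_ball (0 : ℂ) hR2.ne', mem_sphere_zero_iff_norm] at hζ
    have hζ0 : ζ ≠ 0 := fun h0 ↦ by rw [h0, norm_zero] at hζ; linarith
    have hζball : ζ ∈ ball (0 : ℂ) R := by rw [mem_ball_zero_iff, hζ]; linarith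
    obtain ⟨-, -, hgrowth⟩ := AreaThm.distortion_ball hR hf hinj hζball
    rw [sub_zero, hζ] at hgrowth
    have hq : R / 2 / R = 1 / 2 := by field_simp
    rw [hq] at hgrowth
    have h1 : ‖f ζ - f 0‖ ≤ 2 * ‖d‖ * R := by
      have : (1 / 2 : ℝ) / (1 - 1 / 2) ^ 2 = 2 := by norm_num
      rw [this] at hgrowth
      rw [hd]; linarith
    have h2 : ‖h ζ‖ ≤ 5 / 2 * ‖d‖ * R := by
      rw [hh]; dsimp only
      calc ‖f ζ - f 0 - d * ζ‖ ≤ ‖f ζ - f 0‖ + ‖d * ζ‖ := norm_sub_le _ _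
        _ ≤ 2 * ‖d‖ * R + ‖d‖ * (R / 2) := by rw [norm_mul, hζ]; linarith
        _ = 5 / 2 * ‖d‖ * R := by ring
    rw [hkval ζ hζ0, norm_div, hζ, div_le_iff₀ hR2]
    linarith
  have hbound : ∀ ζ ∈ closure (ball (0 : ℂ) (R / 2)), ‖k ζ‖ ≤ 5 * ‖d‖ := fun ζ hζ ↦
    Complex.norm_le_of_forall_mem_frontier_norm_le isBounded_ball (hkd.mono hclsub).diffContOnCl
      hsphere hζ
  -- Schwarz lemma for `k` on `B(0, R/2)`
  have hmaps : MapsTo k (ball (0 : ℂ) (R / 2)) (closedBall (k 0) (5 * ‖d‖)) := fun ζ hζ ↦ by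
    rw [mem_closedBall, hk0, dist_zero_right]
    exact hbound ζ (subset_closure hζ)
  by_cases hw0 : w = 0
  · rw [hw0]; simp
  have hwball : w ∈ ball (0 : ℂ) (R / 2) := mem_ball_zero_iff.2 hw
  have hschwarz := Complex.dist_le_div_mul_dist_of_mapsTo_ball
    (hkd.mono (ball_subset_ball (by linarith))) hmaps hwball
  rw [hk0, dist_zero_right, dist_zero_right, hkval w hw0, norm_div] at hschwarz
  have hwpos : 0 < ‖w‖ := norm_pos_iff.2 hw0
  rw [div_le_iff₀ hwpos] at hschwarz
  calc ‖f w - f 0 - d * w‖ = ‖h w‖ := rfl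
    _ ≤ 5 * ‖d‖ / (R / 2) * ‖w‖ * ‖w‖ := hschwarz
    _ = 10 * ‖d‖ * ‖w‖ ^ 2 / R := by field_simp; ring

/-- **Cones are almost preserved near the centre.** Let `f` be holomorphic and injective on
`B(0, R)` with `f(0) = 0` and `f'(0) = d > 0`. If `z` lies in the cone `{|re z| ≤ c im z}`
(`0 < c`) and `‖z‖ ≤ R/(80 √(1+c²))`, then `f z` lies in the cone `{|re w| ≤ (2c+1) im w}` and
`(3/4) d ‖z‖ ≤ ‖f z‖ ≤ (5/4) d ‖z‖`. [folklore] -/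
theorem image_mem_cone_of_univalent (hR : 0 < R) (hf : DifferentiableOn ℂ f (ball (0 : ℂ) R))
    (hinj : InjOn f (ball (0 : ℂ) R)) (hf0 : f 0 = 0) {d : ℝ} (hd : deriv f 0 = d) (hdpos : 0 < d)
    {c : ℝ} (hc : 0 < c) {z : ℂ} (hz : |z.re| ≤ c * z.im)
    (hzR : ‖z‖ ≤ R / (80 * Real.sqrt (1 + c ^ 2))) :
    |(f z).re| ≤ (2 * c + 1) * (f z).im ∧ 3 / 4 * d * ‖z‖ ≤ ‖f z‖ ∧ ‖f z‖ ≤ 5 / 4 * d * ‖z‖ := by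
  have hs : 1 ≤ Real.sqrt (1 + c ^ 2) := by
    rw [Real.le_sqrt (by norm_num) (by positivity)]; nlinarith
  have hspos : 0 < Real.sqrt (1 + c ^ 2) := by linarith
  have hzR' : ‖z‖ < R / 2 := by
    have h1 : R / (80 * Real.sqrt (1 + c ^ 2)) ≤ R / 80 :=
      div_le_div_of_nonneg_left hR.le (by norm_num) (by nlinarith)
    linarith
  -- the linearisation error `E = f z - d z`, `‖E‖ ≤ 10 d ‖z‖²/R ≤ d ‖z‖/(8 √(1+c²))`
  have herr := norm_sub_linear_le hR hf hinj hzR'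
  rw [hf0, sub_zero, hd] at herr
  have hdn : ‖(d : ℂ)‖ = d := by rw [Complex.norm_real, Real.norm_eq_abs, abs_of_pos hdpos]
  rw [hdn] at herr
  set E : ℂ := f z - d * z with hE
  have hEle : ‖E‖ ≤ d * ‖z‖ / (8 * Real.sqrt (1 + c ^ 2)) := by
    refine herr.trans ?_
    rw [div_le_div_iff₀ hR (by positivity)]
    have h1 : ‖z‖ * (80 * Real.sqrt (1 + c ^ 2)) ≤ R := by
      rwa [le_div_iff₀ (by positivity)] at hzR
    have h2 : 0 ≤ d * ‖z‖ := by positivity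
    calc 10 * d * ‖z‖ ^ 2 * (8 * Real.sqrt (1 + c ^ 2)) = d * ‖z‖ * (‖z‖ * (80 * Real.sqrt (1 + c ^ 2))) := by
          ring
      _ ≤ d * ‖z‖ * R := by gcongr
  -- in the cone, `im z ≥ 0` and `‖z‖ ≤ √(1+c²) im z`
  have him : 0 ≤ z.im := by
    by_contra hneg
    push Not at hneg
    have : c * z.im < 0 := mul_neg_of_pos_of_neg hc hneg
    linarith [abs_nonneg z.re]
  have hnorm : ‖z‖ ≤ Real.sqrt (1 + c ^ 2) * z.im := by
    have hsq : ‖z‖ ^ 2 = z.re ^ 2 + z.im ^ 2 := by rw [Complex.sq_norm, Complex.normSq_apply]; ring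
    have h4 : z.re ^ 2 ≤ (c * z.im) ^ 2 := by
      have : |z.re| ^ 2 ≤ (c * z.im) ^ 2 := pow_le_pow_left₀ (abs_nonneg _) hz 2
      rwa [sq_abs] at this
    have h5 : ‖z‖ ^ 2 ≤ (1 + c ^ 2) * z.im ^ 2 := by nlinarith
    have := (Real.le_sqrt (norm_nonneg z) (by positivity)).2 h5
    rwa [Real.sqrt_mul (by positivity), Real.sqrt_sq him] at this
  have hEim : ‖E‖ ≤ d * z.im / 8 := by
    refine hEle.trans ?_
    rw [div_le_div_iff₀ (by positivity) (by norm_num)]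
    have := mul_le_mul_of_nonneg_left hnorm hdpos.le
    nlinarith
  have hEz : ‖E‖ ≤ d * ‖z‖ / 8 := by
    refine hEle.trans ?_
    rw [div_le_div_iff₀ (by positivity) (by norm_num)]
    have h2 : 0 ≤ d * ‖z‖ := by positivity
    nlinarith
  -- real and imaginary parts of `f z = d z + E`
  have hfz : f z = d * z + E := by rw [hE]; ring
  have hre : (f z).re = d * z.re + E.re := by rw [hfz]; simp
  have himf : (f z).im = d * z.im + E.im := by rw [hfz]; simp
  have hEre : |E.re| ≤ ‖E‖ := Complex.abs_re_le_norm E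
  have hEim' : |E.im| ≤ ‖E‖ := Complex.abs_im_le_norm E
  refine ⟨?_, ?_, ?_⟩
  · rw [hre, himf]
    have h1 : |d * z.re + E.re| ≤ d * (c * z.im) + ‖E‖ := by
      calc |d * z.re + E.re| ≤ |d * z.re| + |E.re| := abs_add_le _ _
        _ ≤ d * (c * z.im) + ‖E‖ := by
            rw [abs_mul, abs_of_pos hdpos]
            exact add_le_add (mul_le_mul_of_nonneg_left hz hdpos.le) hEre
    have h2 : d * z.im - ‖E‖ ≤ d * z.im + E.im := by linarith [(abs_le.1 hEim').1]
    have h3 : 0 ≤ d * z.im := by positivity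
    nlinarith [h1, h2, hEim, hc.le]
  · have h1 : ‖(d : ℂ) * z‖ ≤ ‖(d : ℂ) * z + E‖ + ‖E‖ := by
      simpa using norm_sub_le ((d : ℂ) * z + E) E
    rw [norm_mul, hdn, ← hfz] at h1
    have h2 : 0 ≤ d * ‖z‖ := by positivity
    linarith
  · have h1 : ‖f z‖ ≤ ‖(d : ℂ) * z‖ + ‖E‖ := by rw [hfz]; exact norm_add_le _ _
    rw [norm_mul, hdn] at h1
    have h2 : 0 ≤ d * ‖z‖ := by positivity
    linarith

end Literature.Analysis.Complex
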